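import Mathlib.Algebra.BigOperators.Module
import Mathlib.Analysis.Calculus.MeanValue
import Literature.NumberTheory.Sieve.PolymathGEHPrimePieceLevel
import Summits.Parity.GeneralizedHardyLittlewood.Theorems.BeyondDiagonalBeatsQuarter.OffDiagLevelAP
import HarnessLib

/-!
# Route `PrimeLevelFamEdge`, crux K_B (stmt-Parity-20343), line `diagonal_kernel_split` rev 4, plan Ω (KEYS-NEXT S2) —
# **the partial-summation bridge: level deviations of a smooth weight over the primes of `(N, M]`
# through the COUNT discrepancies `π(y; n, a) − π(y)/φ(n)` that Bombieri–Vinogradov / Siegel–Walfisz speak**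

After the divisor switch (`OffDiagDivisorSwitch`) and the principal/deviation split (`OffDiagLevelAP`:
`levelAPSum = levelPrincipal + levelDeviation`), the a8R/a8S pieces of the dual head are sums of
`levelDeviation Q F n a = Σ_{q ∈ Q, q ≡ a (n)} F q − φ(n)⁻¹ Σ_{q ∈ Q, (q,n)=1} F q` with `Q` the (good) prime levels of a
block `(N, 2N]` and `F` the dual weight, a smooth function of the level. The level-of-distribution inputs of the tree
(`Literature.NumberTheory.Sieve.bombieri_vinogradov`, `siegel_walfisz`, `PrimesHaveLevelPi`,
`Chen.eventually_sum_abs_primeCountingDisc_le`, `sum_iSup_apDiscrepancy_primePiece_le`) speak of COUNTING functions in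
progressions. This file is the exact Abel-summation bridge between the two and the resulting bound:

* `sum_mul_eq_abel` — generic discrete Abel summation for `Σ_{q ∈ Q} w q · F q`, `Q ⊆ (N, M]`, against the partial sums
  `Σ_{q ∈ Q, q ≤ i} w q`; specialised: `levelAPSum_eq_abel`, `levelCoprimeSum_eq_abel`, **`levelDeviation_eq_abel`**
  (`levelDeviation Q F n a = F M · D(M) − Σ_{N<i<M} (F(i+1) − F i) · D(i)`, `D(i)` = the deviation of the COUNT of
  `Q ∩ [0, i]` in the class, i.e. `levelDeviation (Q.filter (· ≤ i)) 1 n a`);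
* `norm_levelDeviation_le_of_counts` — `‖levelDeviation Q F n a‖ ≤ E · (‖F M‖ + Σ_{N<i<M} ‖F(i+1) − F i‖)` whenever
  `‖D(i)‖ ≤ E` on `(N, M]`; `sum_norm_sub_succ_le_of_deriv` — the variation of a `C¹` weight is `≤ (M − N)·sup‖f′‖`;
  `norm_levelDeviation_le_of_deriv` — the two combined;
* for `Q` = the primes of `(N, M]`: **`levelDeviation_primes_one_eq_apDiscrepancy`** — `D(i)` IS Polymath's discrepancy
  `apDiscrepancy (primePiece N i) i n a` of the prime piece `1_{primes ∈ (N, i]}` (the object of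
  `Literature.NumberTheory.Sieve.sum_iSup_apDiscrepancy_primePiece_le`), hence (`abs_apDiscrepancy_primePiece_le`)
  `‖D(i)‖ ≤ |primeCountingDisc n a i| + |primeCountingDisc n a N| + ω(n)/φ(n)` (`norm_levelDeviation_primes_one_le`); and the
  assembled **`norm_levelDeviation_primes_le_of_deriv`**: for a unit class `a`, `n ≥ 1`, `N ≤ M` and a weight `f`
  differentiable on `[N, M]` with `‖f′‖ ≤ B` there,
  `‖levelDeviation (primes of (N,M]) (f ∘ ↑) n a‖ ≤ (2·max_{y ∈ {N..M}} |π(y;n,a) − π(y)/φ(n)| + ω(n)/φ(n)) · (‖f M‖ + (M − N)·B)`,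
  `π(y;n,a) − π(y)/φ(n)` being the tree's `Literature.NumberTheory.Sieve.primeCountingDisc n a y` — the summand of the PROVED
  `π`-form of Bombieri–Vinogradov (`Chen.eventually_sum_abs_primeCountingDisc_le`, `abs_primeCountingDisc_le_iSup`).

Pure finite algebra + the one-dimensional mean value inequality; theorems only; standard axioms. Helper toward
`stub_offDiagBelowSlack_io` (interface of L7/L8 of OMEGA-BLUEPRINT v4); closes nothing.
«The programme SEARCHES and TYPES; no claim about Landau–Siegel zeros, Theorems 1–2 of arXiv:2211.02515 or
a repaired Margin232 until a kernel theorem says so.»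
-/

noncomputable section

namespace Summit.Parity.GeneralizedHardyLittlewood.Theorems.BeyondDiagonalBeatsQuarter.OffDiag

open Finset

/-! ### Generic discrete Abel summation over a finite set inside `(N, M]` -/

/-- Partial sums of a weight extended by zero off `Q`: `Σ_{j < k} 1_Q(j) w j = Σ_{q ∈ Q, q < k} w q`. [folklore] -/
theorem sum_range_ite_mem_eq (Q : Finset ℕ) (w : ℕ → ℂ) (k : ℕ) :
    ∑ j ∈ range k, (if j ∈ Q then w j else 0) = ∑ q ∈ Q.filter (· < k), w q := by
  rw [← Finset.sum_filter]
  congr 1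
  ext j
  simp only [Finset.mem_filter, Finset.mem_range, and_comm]

/-- **Discrete Abel summation on `(N, M]`.** For `Q ⊆ (N, M]` and any weights `w F : ℕ → ℂ`,
`Σ_{q ∈ Q} w q · F q = F(M) · Σ_{q ∈ Q} w q − Σ_{i ∈ (N, M−1]} (F(i+1) − F(i)) · Σ_{q ∈ Q, q ≤ i} w q`
(Mathlib's `Finset.sum_Ioc_by_parts` for the zero extension of `w`). [folklore] -/
theorem sum_mul_eq_abel {Q : Finset ℕ} {N M : ℕ} (hQ : Q ⊆ Ioc N M) (w F : ℕ → ℂ) :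
    ∑ q ∈ Q, w q * F q =
      F M * ∑ q ∈ Q, w q -
        ∑ i ∈ Ioc N (M - 1), (F (i + 1) - F i) * ∑ q ∈ Q.filter (· ≤ i), w q := by
  rcases le_or_gt M N with hMN | hNM
  · have hQe : Q = ∅ := Finset.subset_empty.mp (by rwa [Finset.Ioc_eq_empty (not_lt.mpr hMN)] at hQ)
    have hI : Ioc N (M - 1) = ∅ := Finset.Ioc_eq_empty (by omega)
    simp [hQe, hI]
  · set c : ℕ → ℂ := fun j ↦ if j ∈ Q then w j else 0 with hc
    have hL : ∑ q ∈ Q, w q * F q = ∑ i ∈ Ioc N M, F i • c i := by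
      rw [← Finset.sum_subset hQ (f := fun i ↦ F i • c i)]
      · refine Finset.sum_congr rfl fun q hq ↦ ?_
        simp only [hc, if_pos hq, smul_eq_mul, mul_comm]
      · intro i _ hi
        simp only [hc, if_neg hi, smul_zero]
    have hG : ∀ k, ∑ j ∈ range k, c j = ∑ q ∈ Q.filter (· < k), w q := fun k ↦ sum_range_ite_mem_eq Q w k
    rw [hL, Finset.sum_Ioc_by_parts F c hNM]
    simp only [hG, smul_eq_mul]
    have h1 : Q.filter (· < M + 1) = Q := by
      refine Finset.filter_true_of_mem fun q hq ↦ ?_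
      have := Finset.mem_Ioc.mp (hQ hq); omega
    have h2 : Q.filter (· < N + 1) = ∅ := by
      refine Finset.filter_false_of_mem fun q hq ↦ ?_
      have := Finset.mem_Ioc.mp (hQ hq); omega
    have h3 : ∀ i, Q.filter (· < i + 1) = Q.filter (· ≤ i) := fun i ↦
      Finset.filter_congr fun _ _ ↦ Nat.lt_succ_iff
    rw [h1, h2]
    simp only [h3, Finset.sum_empty, mul_zero, sub_zero]

/-! ### The level sums as weighted sums, and their Abel forms -/

variable (Q : Finset ℕ) (F : ℕ → ℂ) (n : ℕ)

/-- `levelAPSum Q F n a = Σ_{q ∈ Q} 1_{q ≡ a} · F q`. [folklore] -/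
theorem levelAPSum_eq_sum_ite (a : ZMod n) :
    levelAPSum Q F n a = ∑ q ∈ Q, (if (q : ZMod n) = a then (1 : ℂ) else 0) * F q := by
  rw [levelAPSum, Finset.sum_filter]
  refine Finset.sum_congr rfl fun q _ ↦ ?_
  split_ifs <;> simp

open Classical in
/-- `levelCoprimeSum Q F n = Σ_{q ∈ Q} 1_{(q,n)=1} · F q`. [folklore] -/
theorem levelCoprimeSum_eq_sum_ite :
    levelCoprimeSum Q F n = ∑ q ∈ Q, (if IsUnit ((q : ℕ) : ZMod n) then (1 : ℂ) else 0) * F q := by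
  rw [levelCoprimeSum, Finset.sum_filter]
  refine Finset.sum_congr rfl fun q _ ↦ ?_
  split_ifs <;> simp

open Classical in
/-- `levelDeviation Q F n a = Σ_{q ∈ Q} (1_{q ≡ a} − φ(n)⁻¹ 1_{(q,n)=1}) · F q`. [folklore] -/
theorem levelDeviation_eq_sum_weight (a : ZMod n) :
    levelDeviation Q F n a =
      ∑ q ∈ Q, ((if (q : ZMod n) = a then (1 : ℂ) else 0) -
        (Nat.totient n : ℂ)⁻¹ * (if IsUnit ((q : ℕ) : ZMod n) then (1 : ℂ) else 0)) * F q := by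
  rw [levelDeviation, levelPrincipal, levelAPSum_eq_sum_ite, levelCoprimeSum_eq_sum_ite, Finset.mul_sum,
    ← Finset.sum_sub_distrib]
  refine Finset.sum_congr rfl fun q _ ↦ ?_
  ring

variable {Q} {N M : ℕ}

/-- **Abel form of a class sum**: for `Q ⊆ (N, M]`,
`levelAPSum Q F n a = F(M)·#{q ∈ Q : q ≡ a} − Σ_{i ∈ (N, M−1]} (F(i+1) − F(i))·#{q ∈ Q : q ≤ i, q ≡ a}`
(the counts written as `levelAPSum _ 1`). [folklore] -/
theorem levelAPSum_eq_abel (hQ : Q ⊆ Ioc N M) (a : ZMod n) :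
    levelAPSum Q F n a =
      F M * levelAPSum Q (fun _ ↦ 1) n a -
        ∑ i ∈ Ioc N (M - 1), (F (i + 1) - F i) * levelAPSum (Q.filter (· ≤ i)) (fun _ ↦ 1) n a := by
  simp only [levelAPSum_eq_sum_ite, mul_one]
  exact sum_mul_eq_abel hQ _ F

/-- **Abel form of the coprime sum**: for `Q ⊆ (N, M]`,
`levelCoprimeSum Q F n = F(M)·#{q ∈ Q : (q,n)=1} − Σ_{i ∈ (N, M−1]} (F(i+1) − F(i))·#{q ∈ Q : q ≤ i, (q,n)=1}`. [folklore] -/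
theorem levelCoprimeSum_eq_abel (hQ : Q ⊆ Ioc N M) :
    levelCoprimeSum Q F n =
      F M * levelCoprimeSum Q (fun _ ↦ 1) n -
        ∑ i ∈ Ioc N (M - 1), (F (i + 1) - F i) * levelCoprimeSum (Q.filter (· ≤ i)) (fun _ ↦ 1) n := by
  simp only [levelCoprimeSum_eq_sum_ite, mul_one]
  exact sum_mul_eq_abel hQ _ F

/-- **Abel form of the deviation** (partial summation against the COUNT deviations): for `Q ⊆ (N, M]`,
`levelDeviation Q F n a = F(M)·D(M) − Σ_{i ∈ (N, M−1]} (F(i+1) − F(i))·D(i)` with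
`D(i) = levelDeviation (Q ∩ [0,i]) 1 n a = #{q ∈ Q ∩ [0,i] : q ≡ a} − φ(n)⁻¹ #{q ∈ Q ∩ [0,i] : (q,n)=1}`. [folklore] -/
theorem levelDeviation_eq_abel (hQ : Q ⊆ Ioc N M) (a : ZMod n) :
    levelDeviation Q F n a =
      F M * levelDeviation Q (fun _ ↦ 1) n a -
        ∑ i ∈ Ioc N (M - 1), (F (i + 1) - F i) * levelDeviation (Q.filter (· ≤ i)) (fun _ ↦ 1) n a := by
  simp only [levelDeviation_eq_sum_weight, mul_one]
  exact sum_mul_eq_abel hQ _ F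

/-- For `Q ⊆ (N, M]`, truncating at `M` does nothing. [folklore] -/
theorem filter_le_eq_self_of_subset_Ioc (hQ : Q ⊆ Ioc N M) : Q.filter (· ≤ M) = Q :=
  Finset.filter_true_of_mem fun _ hq ↦ (Finset.mem_Ioc.mp (hQ hq)).2

/-- **The deviation of a weighted class sum is controlled by the COUNT deviations and the variation of the weight**:
if `Q ⊆ (N, M]` and `‖D(i)‖ ≤ E` for all `i ∈ (N, M]` (`D` as in `levelDeviation_eq_abel`, `E ≥ 0`), then
`‖levelDeviation Q F n a‖ ≤ E · (‖F M‖ + Σ_{i ∈ (N, M−1]} ‖F(i+1) − F(i)‖)`. [folklore] -/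
theorem norm_levelDeviation_le_of_counts (hQ : Q ⊆ Ioc N M) (a : ZMod n) {E : ℝ} (hE0 : 0 ≤ E)
    (hE : ∀ i ∈ Ioc N M, ‖levelDeviation (Q.filter (· ≤ i)) (fun _ ↦ (1 : ℂ)) n a‖ ≤ E) :
    ‖levelDeviation Q F n a‖ ≤ E * (‖F M‖ + ∑ i ∈ Ioc N (M - 1), ‖F (i + 1) - F i‖) := by
  rcases le_or_gt M N with hMN | hNM
  · have hQe : Q = ∅ := Finset.subset_empty.mp (by rwa [Finset.Ioc_eq_empty (not_lt.mpr hMN)] at hQ)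
    subst hQe
    have h0 : levelDeviation ∅ F n a = 0 := by
      simp [levelDeviation, levelAPSum, levelPrincipal, levelCoprimeSum]
    rw [h0, norm_zero]
    positivity
  · rw [levelDeviation_eq_abel F n hQ a]
    have hEM : ‖levelDeviation Q (fun _ ↦ (1 : ℂ)) n a‖ ≤ E := by
      have := hE M (Finset.mem_Ioc.mpr ⟨hNM, le_rfl⟩)
      rwa [filter_le_eq_self_of_subset_Ioc hQ] at this
    have hsub : Ioc N (M - 1) ⊆ Ioc N M := Finset.Ioc_subset_Ioc_right (Nat.sub_le M 1)
    calc ‖F M * levelDeviation Q (fun _ ↦ 1) n a -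
          ∑ i ∈ Ioc N (M - 1), (F (i + 1) - F i) * levelDeviation (Q.filter (· ≤ i)) (fun _ ↦ 1) n a‖
        ≤ ‖F M * levelDeviation Q (fun _ ↦ 1) n a‖ +
          ‖∑ i ∈ Ioc N (M - 1), (F (i + 1) - F i) * levelDeviation (Q.filter (· ≤ i)) (fun _ ↦ 1) n a‖ :=
          norm_sub_le _ _
      _ ≤ ‖F M‖ * E + ∑ i ∈ Ioc N (M - 1), ‖F (i + 1) - F i‖ * E := by
          refine add_le_add ?_ ((norm_sum_le _ _).trans (Finset.sum_le_sum fun i hi ↦ ?_))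
          · rw [norm_mul]
            exact mul_le_mul_of_nonneg_left hEM (norm_nonneg _)
          · rw [norm_mul]
            exact mul_le_mul_of_nonneg_left (hE i (hsub hi)) (norm_nonneg _)
      _ = E * (‖F M‖ + ∑ i ∈ Ioc N (M - 1), ‖F (i + 1) - F i‖) := by
          rw [← Finset.sum_mul]; ring

/-! ### The variation of a `C¹` weight -/

/-- **Variation of a differentiable weight over consecutive integers**: if `f` is differentiable on `[N, M]` (`N ≤ M`)
with `‖f′‖ ≤ B` there, then `Σ_{i ∈ (N, M−1]} ‖f(i+1) − f(i)‖ ≤ (M − N)·B` (mean value inequality on each `[i, i+1]`).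
[folklore] -/
theorem sum_norm_sub_succ_le_of_deriv {f : ℝ → ℂ} (hNM : N ≤ M) {B : ℝ}
    (hf : ∀ t ∈ Set.Icc (N : ℝ) M, DifferentiableAt ℝ f t)
    (hB : ∀ t ∈ Set.Icc (N : ℝ) M, ‖deriv f t‖ ≤ B) :
    ∑ i ∈ Ioc N (M - 1), ‖f ((i + 1 : ℕ) : ℝ) - f (i : ℝ)‖ ≤ ((M : ℝ) - N) * B := by
  have hNM' : (N : ℝ) ≤ M := by exact_mod_cast hNM
  have hB0 : 0 ≤ B := (norm_nonneg _).trans (hB N ⟨le_rfl, hNM'⟩)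
  have hterm : ∀ i ∈ Ioc N (M - 1), ‖f ((i + 1 : ℕ) : ℝ) - f (i : ℝ)‖ ≤ B := by
    intro i hi
    rw [Finset.mem_Ioc] at hi
    have hiN : (N : ℝ) ≤ i := by exact_mod_cast hi.1.le
    have hiM : ((i + 1 : ℕ) : ℝ) ≤ M := by exact_mod_cast (by omega : i + 1 ≤ M)
    have hi1 : ((i + 1 : ℕ) : ℝ) = (i : ℝ) + 1 := by push_cast; ring
    have h := (convex_Icc (N : ℝ) M).norm_image_sub_le_of_norm_deriv_le hf hB
      (x := (i : ℝ)) (y := ((i + 1 : ℕ) : ℝ)) ⟨hiN, by linarith⟩ ⟨by linarith, hiM⟩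
    rw [hi1] at h ⊢
    simpa using h
  calc ∑ i ∈ Ioc N (M - 1), ‖f ((i + 1 : ℕ) : ℝ) - f (i : ℝ)‖
      ≤ ∑ _i ∈ Ioc N (M - 1), B := Finset.sum_le_sum hterm
    _ = ((Ioc N (M - 1)).card : ℝ) * B := by rw [Finset.sum_const, nsmul_eq_mul]
    _ ≤ ((M : ℝ) - N) * B := by
        refine mul_le_mul_of_nonneg_right ?_ hB0
        rw [Nat.card_Ioc, ← Nat.cast_sub hNM]
        exact_mod_cast (by omega : M - 1 - N ≤ M - N)

/-- **Deviation of a `C¹`-weighted class sum**: for `Q ⊆ (N, M]`, `N ≤ M`, a weight `f` differentiable on `[N, M]` with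
`‖f′‖ ≤ B` there, and count deviations `‖D(i)‖ ≤ E` (`E ≥ 0`) on `(N, M]`:
`‖levelDeviation Q (f ∘ ↑) n a‖ ≤ E · (‖f M‖ + (M − N)·B)`. [folklore] -/
theorem norm_levelDeviation_le_of_deriv (hQ : Q ⊆ Ioc N M) (hNM : N ≤ M) (a : ZMod n) {f : ℝ → ℂ} {B E : ℝ}
    (hE0 : 0 ≤ E)
    (hf : ∀ t ∈ Set.Icc (N : ℝ) M, DifferentiableAt ℝ f t)
    (hB : ∀ t ∈ Set.Icc (N : ℝ) M, ‖deriv f t‖ ≤ B)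
    (hE : ∀ i ∈ Ioc N M, ‖levelDeviation (Q.filter (· ≤ i)) (fun _ ↦ (1 : ℂ)) n a‖ ≤ E) :
    ‖levelDeviation Q (fun q : ℕ ↦ f q) n a‖ ≤ E * (‖f M‖ + ((M : ℝ) - N) * B) := by
  refine (norm_levelDeviation_le_of_counts (fun q : ℕ ↦ f q) n hQ a hE0 hE).trans ?_
  refine mul_le_mul_of_nonneg_left ?_ hE0
  gcongr
  exact sum_norm_sub_succ_le_of_deriv hNM hf hB

/-! ### The primes of `(N, M]`: the count deviations are Polymath's discrepancies of prime pieces -/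

/-- Truncating the primes of `(N, M]` at `i ≤ M` gives the primes of `(N, i]`. [folklore] -/
theorem primesIoc_filter_le {i : ℕ} (hi : i ≤ M) :
    ((Ioc N M).filter Nat.Prime).filter (· ≤ i) = (Ioc N i).filter Nat.Prime := by
  ext q
  simp only [Finset.mem_filter, Finset.mem_Ioc]
  constructor
  · rintro ⟨⟨⟨h1, -⟩, hp⟩, h3⟩
    exact ⟨⟨h1, h3⟩, hp⟩
  · rintro ⟨⟨h1, h3⟩, hp⟩
    exact ⟨⟨⟨h1, h3.trans hi⟩, hp⟩, h3⟩

/-- Sums of the prime piece `1_{primes ∈ (N, i]}` over a filtered `[1, i]` are counts of filtered primes of `(N, i]`.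
[folklore] -/
theorem sum_filter_primePiece_eq_card (N i : ℕ) (p : ℕ → Prop) [DecidablePred p] :
    ∑ k ∈ (Icc 1 i).filter p, (Literature.NumberTheory.Sieve.primePiece N i k : ℝ) =
      ((((Ioc N i).filter Nat.Prime).filter p).card : ℝ) := by
  simp only [Literature.NumberTheory.Sieve.primePiece_apply]
  rw [Finset.sum_boole]
  congr 2
  ext k
  simp only [Finset.mem_filter, Finset.mem_Icc, Finset.mem_Ioc]
  constructor
  · rintro ⟨⟨-, hp⟩, h1, h2, h3⟩
    exact ⟨⟨⟨h1, h2⟩, h3⟩, hp⟩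
  · rintro ⟨⟨⟨h1, h2⟩, h3⟩, hp⟩
    exact ⟨⟨⟨by omega, h2⟩, hp⟩, h1, h2, h3⟩

/-- **The count deviation of the primes of `(N, i]` IS Polymath's discrepancy of the prime piece**:
`levelDeviation (primes of (N,i]) 1 n a = Δ(1_{primes ∈ (N,i]}; i; a (n))` (`Literature.NumberTheory.Sieve.apDiscrepancy`,
the object of `sum_iSup_apDiscrepancy_primePiece_le`). [folklore] -/
theorem levelDeviation_primes_one_eq_apDiscrepancy (N i : ℕ) (a : ZMod n) :
    levelDeviation ((Ioc N i).filter Nat.Prime) (fun _ ↦ (1 : ℂ)) n a =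
      ((Literature.NumberTheory.Sieve.apDiscrepancy
        (fun k ↦ (Literature.NumberTheory.Sieve.primePiece N i k : ℝ)) i n a : ℝ) : ℂ) := by
  classical
  rw [Literature.NumberTheory.Sieve.apDiscrepancy, sum_filter_primePiece_eq_card, sum_filter_primePiece_eq_card,
    levelDeviation, levelPrincipal, levelAPSum, levelCoprimeSum, Finset.sum_const, Finset.sum_const, nsmul_eq_mul,
    nsmul_eq_mul, mul_one, mul_one]
  have hcop : ((Ioc N i).filter Nat.Prime).filter (fun q : ℕ ↦ IsUnit ((q : ℕ) : ZMod n)) =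
      ((Ioc N i).filter Nat.Prime).filter (fun q : ℕ ↦ q.Coprime n) :=
    Finset.filter_congr fun q _ ↦ ZMod.isUnit_iff_coprime q n
  rw [hcop]
  push_cast
  ring

/-- **Count deviation of the primes of `(N, i]` through the `π`-discrepancies**: for `n ≥ 1`, a unit class `a` and `N ≤ i`,
`‖levelDeviation (primes of (N,i]) 1 n a‖ ≤ |primeCountingDisc n a i| + |primeCountingDisc n a N| + ω(n)/φ(n)`
(`Literature.NumberTheory.Sieve.abs_apDiscrepancy_primePiece_le`). [folklore] -/
theorem norm_levelDeviation_primes_one_le (hn : 1 ≤ n) (a : (ZMod n)ˣ) {i : ℕ} (hNi : N ≤ i) :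
    ‖levelDeviation ((Ioc N i).filter Nat.Prime) (fun _ ↦ (1 : ℂ)) n (a : ZMod n)‖ ≤
      |Literature.NumberTheory.Sieve.primeCountingDisc n (a : ZMod n) i| +
        |Literature.NumberTheory.Sieve.primeCountingDisc n (a : ZMod n) N| +
          (ArithmeticFunction.cardDistinctFactors n : ℝ) / Nat.totient n := by
  rw [levelDeviation_primes_one_eq_apDiscrepancy, Complex.norm_real, Real.norm_eq_abs]
  exact Literature.NumberTheory.Sieve.abs_apDiscrepancy_primePiece_le hn a hNi le_rfl

/-- **The bridge, assembled (KEYS-NEXT S2).** For `n ≥ 1`, a unit class `a`, `N ≤ M`, a weight `f` differentiable on `[N, M]`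
with `‖f′‖ ≤ B` there, and `D` with `|π(y;n,a) − π(y)/φ(n)| ≤ D` for all integers `y ∈ [N, M]`
(`Literature.NumberTheory.Sieve.primeCountingDisc n a y`, the summand of the proved `π`-form of Bombieri–Vinogradov):
`‖levelDeviation (primes of (N,M]) (f ∘ ↑) n a‖ ≤ (2D + ω(n)/φ(n)) · (‖f M‖ + (M − N)·B)`. [folklore] -/
theorem norm_levelDeviation_primes_le_of_deriv (hn : 1 ≤ n) (a : (ZMod n)ˣ) (hNM : N ≤ M) {f : ℝ → ℂ} {B D : ℝ}
    (hf : ∀ t ∈ Set.Icc (N : ℝ) M, DifferentiableAt ℝ f t)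
    (hB : ∀ t ∈ Set.Icc (N : ℝ) M, ‖deriv f t‖ ≤ B)
    (hD : ∀ y ∈ Icc N M, |Literature.NumberTheory.Sieve.primeCountingDisc n (a : ZMod n) y| ≤ D) :
    ‖levelDeviation ((Ioc N M).filter Nat.Prime) (fun q : ℕ ↦ f q) n (a : ZMod n)‖ ≤
      (2 * D + (ArithmeticFunction.cardDistinctFactors n : ℝ) / Nat.totient n) * (‖f M‖ + ((M : ℝ) - N) * B) := by
  have hDN := hD N (Finset.mem_Icc.mpr ⟨le_rfl, hNM⟩)
  have hD0 : 0 ≤ D := (abs_nonneg _).trans hDN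
  have hω : 0 ≤ (ArithmeticFunction.cardDistinctFactors n : ℝ) / Nat.totient n := by positivity
  refine norm_levelDeviation_le_of_deriv n (Finset.filter_subset _ _) hNM (a : ZMod n) (by positivity) hf hB ?_
  intro i hi
  rw [Finset.mem_Ioc] at hi
  rw [primesIoc_filter_le hi.2]
  refine (norm_levelDeviation_primes_one_le n hn a hi.1.le).trans ?_
  have hDi := hD i (Finset.mem_Icc.mpr ⟨hi.1.le, hi.2⟩)
  linarith

end Summit.Parity.GeneralizedHardyLittlewood.Theorems.BeyondDiagonalBeatsQuarter.OffDiag
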